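import Literature.MathematicalPhysics.QuantumFieldTheory.Balaban1983to89.B14Eq339Covariance
import Literature.MathematicalPhysics.QuantumFieldTheory.Balaban1983to89.B14Eq333Proof

/-!
# `Balaban1983to89.B14Eq338Concrete` — CMP 119 (3.37)–(3.38) p. 274 with the Gaussian bracket CONCRETE: the typed
# (3.37) `B14.Eq338Localization.E0` instantiated with the tree's corrected-sign log-det bracket
# `B14.Eq339Covariance.gauss337`, and the sentence *"The identities (3.30)–(3.33), (3.36), together with the above
# definition, imply the equality (3.38)"* PROVED with (3.33)/(3.36) DISCHARGED (no `h333` letter), + (3.42) for it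

statement-level skeleton of published theorems with citation tags; proofs where landed; nothing here is a claim
about the Yang–Mills mass gap.

CITATION HEADER (lean-in-tree rule).  Source: T. Bałaban, *Convergent renormalization expansions for lattice gauge
theories*, Commun. Math. Phys. **119**, 243–285 (1988), doi:10.1007/bf01217741 [Balaban1988Convergent] (cell paper
B14 = "[III]"; held `paper:balaban1988-cmp119-convergent-renormalization`, journal page = PDF page + 242; p. 274 read
on the text layer p0032 and the x2 render `…-p032-x2.png`, p. 273 on p0031, p. 275 on p0033).  Mega-formalization
`lit-balaban`, unit `lit-balaban-r11` (CMP 119, B14 fold owner), SKELETON row **B14.Eq3.37–3.39** — the owed member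
named by the owner's READING-RULE audit (`READING-RULE-AUDIT-B14-g96.md` §4: *"(3.37) `E0` has the χ- and ⟨·⟩_t-pieces
CONCRETE but the Gaussian piece as the ABSTRACT letter `gaussB` … Owed: `eq338` ∕ `E0` instantiated with
`gaussB := gauss337`"*) — and row **B14.Eq3.41–3.42** ((3.42) for the same concrete terms).

THE PRINTED TEXT (p. 274 [PDF 32], verbatim).  *"Let us introduce the following definiton:
  𝐄₀^{(k+1)}(Λ_{k+1}, U_{k+1}, b) = χ_{Λ^{(k)*}_{k+1}}(b) [ −½ log λ₀ + ½ ∫₀^∞ dλ (λ₀ + λ)⁻¹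
      · tr((C*Δ^{(k)}C − λ₀I)(C*Δ^{(k)}C + λ)⁻¹)(b, b)
      + ∫₀¹ dt ∫ dμ_{C^{(k)}(Λ_{k+1})} Π_{b′∈Λ^{(k)*}_{k+1}, b′≠b} χ^{(k)}(tA(b′)) (∂/∂t)χ^{(k)}(tA(b)) · (∫ dμ_{C^{(k)}(Λ_{k+1})} χ_t^{(k)})⁻¹ ]
      + g_k ∫₀¹ dt ⟨tr 𝐕_k′(tg_k, A, b)(CA)(b)⟩_t .   (3.37)
The identities (3.30)–(3.33), (3.36), together with the above definition, imply the equality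
  [the logarithm on the right-hand side of (3.28)] = Σ_{c∈Λ^{(k+1)}_{k+1}} log z^{(k)}(c) + Σ_{b∈Λ^{(k)}_{k+1}} 𝐄₀^{(k+1)}(Λ_{k+1}, b) + const .   (3.38)
The constant above is the constant in (3.33), included into the vacuum renormalization E₀^{(k)}."*  And (3.33) p. 273
[PDF 31]: *"log z^{(k)} ∫ dA exp[−½⟨A, C*Δ^{(k)}CA⟩] = Σ_{c} log z^{(k)}(c) − ½ log det(C*Δ^{(k)}C) + log ∫ dA exp[−½|A|²].
The last term is a number, which contributes to the vacuum energy renormalization"*.  ERRATUM OF RECORD (cell GAPS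
G-B14-02 ∕ DIVERGENCE D-pv02.5): the sign of the `½ ∫₀^∞` term printed in (3.36)/(3.37) is refuted as printed
(`B14LogDet336Matrix.eq336_printed_fails_smul_one`) and the corrected `−½ ∫₀^∞` is proved (`eq336_corrected`);
`gauss337` carries the CORRECTED sign, so every theorem below is the corrected (3.37)/(3.38).

WHAT IS PROVED (finite-dimensional Gaussian model of the sibling files: variable indices `i : n` (bond × colour) with
the fibre map `bond : n → β` onto the bond type `β = Λ^{(k)}_{k+1}`, `T = C*Δ^{(k)}C` a positive definite real matrix on
`n`, the "tr(·)(b, b)" of (3.37) = the sum of the diagonal entries over the fibre of `b`, `B14.Eq339Covariance.fiberTrace`).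
§1 The concrete Gaussian bracket: `gauss337 T λ₀ bond b` IS, letter for letter, the per-bond summand of p28/pv02's
   `B14LogDet336Matrix.sum_fiber_eq337_first` (`gauss337_eq_fiber`, `rfl`); it vanishes on bonds with empty fibre
   (`gauss337_of_fiber_empty`) — so when every variable lies over a bond of `Λ^{(k)*}_{k+1}` (`star`; print: the
   integration variables `A(b)`, `b ∈ Λ^{(k)*}_{k+1}`, of (3.28)) the indicator `χ_{Λ*}(b)` of (3.37) costs nothing
   (`sum_gauss337_star`); and `Σ_b gauss337 b = −½ log det T` (`sum_gauss337`, = the corrected (3.36) summed, by name).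
§2 (3.33) + (3.36) ⇒ the hypothesis `h333` of `B14.Eq338Localization.eq338` HOLDS for `gaussB := gauss337 T λ₀ bond`
   with print's constant `const = (|n|/2) log 2π` of (3.33) (`gaussLog_eq_star`; from p28's
   `B14Eq333Proof.eq338_gaussianPart_fiber`).
§3 **(3.38) with NO Gaussian letter**: `eq338_concrete` — from (3.30) in the bond form (3.31) (`h330`), (3.32) in Leibniz
   form (`h332`) and the integrability binders ONLY, `[the logarithm] = Σ_c log z^{(k)}(c) + Σ_b E0 star (gauss337 T λ₀ bond)
   (chiBracket ν star χ χ′) g_k (vBracket Ex f) b + (|n|/2) log 2π`; `eq338_gibbs_concrete` for the tilted expectation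
   of record `InterpolationMeasure.gibbsExpect`; `eq338_CDeltaC` in the printed letters `T = CᵀΔC` (`Δ` positive
   definite, `C` injective — p28's `posDef_transpose_mul_mul`).
§4 (3.42) for these concrete per-bond terms on the whole periodic lattice (`eq342_concrete`: `B14.Eq338Localization.eq342`
   by name, fine bonds `β = X × Fin d`, coarse bonds `γ = Z × Fin d`).
HONEST SCOPE.  What (3.37) still takes as letters after this file: the per-bond characteristic factors `χ b t ω`
(= `χ^{(k)}(tA(ω)(b))`), the expectation family `⟨·⟩_t` (instance of record `gibbsExpect`) and its inserts
`f b t = tr 𝐕_k′(tg_k, A, b)(CA)(b)` — objects of Bałaban's spaces, concrete in the sibling files only at mechanism level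
(row B14.Eq3.30, G.5-45-type input) —, and `λ₀ > 0` (any; print fixes it on p. 273).  (3.39) for exactly these concrete
terms is already `B14.Eq339Covariance.eq339` (mechanism level; which `e`, `P` realise a Euclidean `r` is its input).
Theorems only (no `def`, no structure, no named fact); no `sorry`.
-/

noncomputable section

open _root_.MeasureTheory _root_.Set Finset Matrix
open scoped BigOperators Real

namespace Literature.MathematicalPhysics.QuantumFieldTheory.Balaban1983to89.B14.Eq338Concrete

open Literature.MathematicalPhysics.QuantumFieldTheory.Balaban1983to89
open B14.Eq338Localization B14.Eq339Covariance B14.InterpolationMeasure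

variable {n : Type*} [Fintype n] [DecidableEq n] {β : Type*} [Fintype β] [DecidableEq β]

/-! ## §1  The concrete Gaussian bracket `gauss337` and its bond sum -/

omit [Fintype β] in
/-- `gauss337 T λ₀ bond b` is, letter for letter, the per-bond summand
`−½ log λ₀ · |fibre b| − ½ ∫₀^∞ dλ (λ₀+λ)⁻¹ Σ_{i ∈ fibre b} ((T − λ₀I)(T + λI)⁻¹)(i, i)` of
`B14LogDet336Matrix.sum_fiber_eq337_first` (corrected sign). [cite: Balaban1988Convergent, (3.37) p.274] -/
theorem gauss337_eq_fiber (T : Matrix n n ℝ) (lam0 : ℝ) (bond : n → β) (b : β) :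
    gauss337 T lam0 bond b
      = -(1 / 2 : ℝ) * Real.log lam0 * #{i | bond i = b}
        - (1 / 2 : ℝ) * ∫ x in Ioi (0 : ℝ), (lam0 + x)⁻¹
            * ∑ i ∈ univ.filter (fun i => bond i = b), ((T - lam0 • (1 : Matrix n n ℝ)) * (T + x • 1)⁻¹) i i :=
  rfl

/-- **The corrected (3.36), bond by bond and summed**: for `T` positive definite and any `λ₀ > 0`,
`Σ_{b} gauss337 T λ₀ bond b = −½ log det T` (p. 274: *"−½ log det(C*Δ^{(k)}C) = …"* summed over the bonds; the tree's
`B14LogDet336Matrix.sum_fiber_eq337_first` by name). [cite: Balaban1988Convergent, (3.36)–(3.37) p.274] -/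
theorem sum_gauss337 {T : Matrix n n ℝ} (hT : T.PosDef) {lam0 : ℝ} (h0 : 0 < lam0) (bond : n → β) :
    ∑ b, gauss337 T lam0 bond b = -(1 / 2 : ℝ) * Real.log T.det := by
  simp only [gauss337_eq_fiber]
  exact B14LogDet336Matrix.sum_fiber_eq337_first bond hT h0

omit [Fintype β] in
/-- A bond over which no variable lies contributes nothing: `fibre b = ∅ ⇒ gauss337 T λ₀ bond b = 0` (the indicator
`χ_{Λ^{(k)*}_{k+1}}(b)` of (3.37) in the model: the variables `A(b)` of (3.28) live on `Λ^{(k)*}_{k+1}`).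
[cite: Balaban1988Convergent, (3.37) p.274] -/
theorem gauss337_of_fiber_empty (T : Matrix n n ℝ) (lam0 : ℝ) {bond : n → β} {b : β} (h : ∀ i, bond i ≠ b) :
    gauss337 T lam0 bond b = 0 := by
  have he : univ.filter (fun i => bond i = b) = ∅ :=
    Finset.filter_eq_empty_iff.2 fun i _ => h i
  rw [gauss337_eq_fiber]
  simp [he]

/-- Hence, when every variable lies over a bond of `star = Λ^{(k)*}_{k+1}`, the restricted and the full bond sums of the
Gaussian bracket agree: `Σ_{b ∈ Λ*} gauss337 b = Σ_b gauss337 b`. [cite: Balaban1988Convergent, (3.37)–(3.38) p.274] -/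
theorem sum_gauss337_star (T : Matrix n n ℝ) (lam0 : ℝ) {bond : n → β} {star : Finset β}
    (hbond : ∀ i, bond i ∈ star) :
    ∑ b ∈ star, gauss337 T lam0 bond b = ∑ b, gauss337 T lam0 bond b := by
  refine (Finset.sum_subset (Finset.subset_univ star) fun b _ hb => ?_)
  exact gauss337_of_fiber_empty T lam0 fun i hi => hb (hi ▸ hbond i)

/-! ## §2  (3.33) + (3.36): the Gaussian logarithm of (3.30) IS `Σ_c log z^{(k)}(c) + Σ_{b∈Λ*} gauss337 b + const` -/

/-- **The hypothesis `h333` of `B14.Eq338Localization.eq338` DISCHARGED for `gaussB := gauss337 T λ₀ bond`**: for `T`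
positive definite, `z^{(k)}(c) > 0`, any `λ₀ > 0`, and all variables over `Λ*`,
`log[(∏_c z c) ∫ dA exp(−½⟨A,TA⟩)] = Σ_c log z c + Σ_{b ∈ Λ*} gauss337 T λ₀ bond b + (|n|/2)·log 2π` — (3.33) with the
corrected (3.36)/(3.37)₁ (p28's `B14Eq333Proof.eq338_gaussianPart_fiber` by name); the constant is *"the constant in
(3.33)"*. [cite: Balaban1988Convergent, (3.33) p.273, (3.38) p.274] -/
theorem gaussLog_eq_star {γ : Type*} [Fintype γ] {z : γ → ℝ} (hz : ∀ c, 0 < z c) {T : Matrix n n ℝ}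
    (hT : T.PosDef) {lam0 : ℝ} (h0 : 0 < lam0) {bond : n → β} {star : Finset β} (hbond : ∀ i, bond i ∈ star) :
    Real.log ((∏ c, z c) * ∫ A : n → ℝ, Real.exp (-(1/2 : ℝ) * (A ⬝ᵥ T *ᵥ A)))
      = ∑ c, Real.log (z c) + ∑ b ∈ star, gauss337 T lam0 bond b
        + (Fintype.card n : ℝ) / 2 * Real.log (2 * π) := by
  rw [sum_gauss337_star T lam0 hbond]
  simp only [gauss337_eq_fiber]
  exact B14Eq333Proof.eq338_gaussianPart_fiber bond hz hT h0

/-! ## §3  (3.38) with the Gaussian bracket concrete -/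

section Eq338

variable {γ : Type*} [Fintype γ] {Ω : Type*} [MeasurableSpace Ω]

/-- **(3.38) for the concrete (corrected) (3.37)** — *"The identities (3.30)–(3.33), (3.36), together with the above
definition, imply the equality [the logarithm on the right-hand side of (3.28)] = Σ_c log z^{(k)}(c)
+ Σ_b 𝐄₀^{(k+1)}(Λ_{k+1}, b) + const"*, with (3.33)/(3.36) DISCHARGED: data `T = C*Δ^{(k)}C` positive definite on the
variable indices `n`, fibre map `bond : n → β` into `star = Λ^{(k)*}_{k+1}`, `z^{(k)}(c) > 0`, any `λ₀ > 0`; hypotheses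
(3.30) in the bond form (3.31) (`h330`, its Gaussian term now the GENUINE `log[(∏ z) ∫ dA e^{−½⟨A,TA⟩}]`), (3.32) in
Leibniz form (`h332`) and the integrability binders of `eq338`; conclusion with `𝐄₀ = E0 star (gauss337 T λ₀ bond)
(chiBracket ν star χ χ′) g (vBracket Ex f)` and `const = (|n|/2) log 2π`. [cite: Balaban1988Convergent, (3.38) p.274] -/
theorem eq338_concrete {L chiLog g : ℝ} {z : γ → ℝ} (hz : ∀ c, 0 < z c) {T : Matrix n n ℝ} (hT : T.PosDef)
    {lam0 : ℝ} (h0 : 0 < lam0) {bond : n → β} {star : Finset β} (hbond : ∀ i, bond i ∈ star)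
    {ν : Measure Ω} {χ χ' : β → ℝ → Ω → ℝ} {Ex : ℝ → (Ω → ℝ) → ℝ} {f : β → ℝ → Ω → ℝ}
    (h330 : L = Real.log ((∏ c, z c) * ∫ A : n → ℝ, Real.exp (-(1/2 : ℝ) * (A ⬝ᵥ T *ᵥ A)))
      + chiLog + g * ∫ t in (0:ℝ)..1, Ex t (fun ω => ∑ b, f b t ω))
    (h332 : chiLog = ∫ t in (0:ℝ)..1, (∫ ω, dchiProd star χ χ' t ω ∂ν) * (∫ ω, chiProd star χ t ω ∂ν)⁻¹)
    (hχ : ∀ t ∈ Icc (0:ℝ) 1, ∀ b ∈ star, Integrable (fun ω => (∏ b' ∈ star.erase b, χ b' t ω) * χ' b t ω) ν)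
    (hχt : ∀ b ∈ star, IntervalIntegrable
      (fun t => (∫ ω, (∏ b' ∈ star.erase b, χ b' t ω) * χ' b t ω ∂ν) * (∫ ω, chiProd star χ t ω ∂ν)⁻¹) volume 0 1)
    (hEx : ∀ t ∈ Icc (0:ℝ) 1, Ex t (fun ω => ∑ b, f b t ω) = ∑ b, Ex t (f b t))
    (hft : ∀ b, IntervalIntegrable (fun t => Ex t (f b t)) volume 0 1) :
    L = ∑ c, Real.log (z c)
      + ∑ b, E0 star (gauss337 T lam0 bond) (chiBracket ν star χ χ') g (vBracket Ex f) b
      + (Fintype.card n : ℝ) / 2 * Real.log (2 * π) :=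
  eq338 h330 (gaussLog_eq_star hz hT h0 hbond) h332 hχ hχt hEx hft

/-- **(3.38), concrete Gaussian bracket, for the instance of record of `⟨·⟩_t`** (`InterpolationMeasure.gibbsExpect ν′ w S`,
the tilted expectation of (3.27)/(3.30)): additivity over the bonds discharged by `gibbsExpect_finset_sum`.
[cite: Balaban1988Convergent, (3.38) p.274] -/
theorem eq338_gibbs_concrete {L chiLog g : ℝ} {z : γ → ℝ} (hz : ∀ c, 0 < z c) {T : Matrix n n ℝ} (hT : T.PosDef)
    {lam0 : ℝ} (h0 : 0 < lam0) {bond : n → β} {star : Finset β} (hbond : ∀ i, bond i ∈ star)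
    {ν : Measure Ω} {χ χ' : β → ℝ → Ω → ℝ} {ν' : Measure Ω} {w : Ω → ℝ} {S : ℝ → Ω → ℝ} {f : β → ℝ → Ω → ℝ}
    (h330 : L = Real.log ((∏ c, z c) * ∫ A : n → ℝ, Real.exp (-(1/2 : ℝ) * (A ⬝ᵥ T *ᵥ A)))
      + chiLog + g * ∫ t in (0:ℝ)..1, gibbsExpect ν' w S (fun ω => ∑ b, f b t ω) t)
    (h332 : chiLog = ∫ t in (0:ℝ)..1, (∫ ω, dchiProd star χ χ' t ω ∂ν) * (∫ ω, chiProd star χ t ω ∂ν)⁻¹)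
    (hχ : ∀ t ∈ Icc (0:ℝ) 1, ∀ b ∈ star, Integrable (fun ω => (∏ b' ∈ star.erase b, χ b' t ω) * χ' b t ω) ν)
    (hχt : ∀ b ∈ star, IntervalIntegrable
      (fun t => (∫ ω, (∏ b' ∈ star.erase b, χ b' t ω) * χ' b t ω ∂ν) * (∫ ω, chiProd star χ t ω ∂ν)⁻¹) volume 0 1)
    (hfw : ∀ t ∈ Icc (0:ℝ) 1, ∀ b, Integrable (fun ω => f b t ω * gibbsWeight w S t ω) ν')
    (hft : ∀ b, IntervalIntegrable (fun t => gibbsExpect ν' w S (f b t) t) volume 0 1) :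
    L = ∑ c, Real.log (z c)
      + ∑ b, E0 star (gauss337 T lam0 bond) (chiBracket ν star χ χ')
          g (vBracket (fun t G => gibbsExpect ν' w S G t) f) b
      + (Fintype.card n : ℝ) / 2 * Real.log (2 * π) :=
  eq338_gibbs h330 (gaussLog_eq_star hz hT h0 hbond) h332 hχ hχt hfw hft

/-- **(3.38), concrete, in the printed letters `T = C*Δ^{(k)}C`**: `Δ = Δ^{(k)}` positive definite on the fine-field
indices `m`, `C : m × n` injective (p. 273: the spectrum of `C*Δ^{(k)}C` lies in `Re z ≥ r > 0`; positivity by p28's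
`B14Eq333Proof.posDef_transpose_mul_mul`). [cite: Balaban1988Convergent, (3.33) p.273, (3.38) p.274] -/
theorem eq338_CDeltaC {m : Type*} [Fintype m] {Δ : Matrix m m ℝ} (hΔ : Δ.PosDef) {C : Matrix m n ℝ}
    (hC : Function.Injective C.mulVec) {L chiLog g : ℝ} {z : γ → ℝ} (hz : ∀ c, 0 < z c)
    {lam0 : ℝ} (h0 : 0 < lam0) {bond : n → β} {star : Finset β} (hbond : ∀ i, bond i ∈ star)
    {ν : Measure Ω} {χ χ' : β → ℝ → Ω → ℝ} {Ex : ℝ → (Ω → ℝ) → ℝ} {f : β → ℝ → Ω → ℝ}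
    (h330 : L = Real.log ((∏ c, z c) * ∫ A : n → ℝ, Real.exp (-(1/2 : ℝ) * (A ⬝ᵥ (Cᵀ * Δ * C) *ᵥ A)))
      + chiLog + g * ∫ t in (0:ℝ)..1, Ex t (fun ω => ∑ b, f b t ω))
    (h332 : chiLog = ∫ t in (0:ℝ)..1, (∫ ω, dchiProd star χ χ' t ω ∂ν) * (∫ ω, chiProd star χ t ω ∂ν)⁻¹)
    (hχ : ∀ t ∈ Icc (0:ℝ) 1, ∀ b ∈ star, Integrable (fun ω => (∏ b' ∈ star.erase b, χ b' t ω) * χ' b t ω) ν)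
    (hχt : ∀ b ∈ star, IntervalIntegrable
      (fun t => (∫ ω, (∏ b' ∈ star.erase b, χ b' t ω) * χ' b t ω ∂ν) * (∫ ω, chiProd star χ t ω ∂ν)⁻¹) volume 0 1)
    (hEx : ∀ t ∈ Icc (0:ℝ) 1, Ex t (fun ω => ∑ b, f b t ω) = ∑ b, Ex t (f b t))
    (hft : ∀ b, IntervalIntegrable (fun t => Ex t (f b t)) volume 0 1) :
    L = ∑ c, Real.log (z c)
      + ∑ b, E0 star (gauss337 (Cᵀ * Δ * C) lam0 bond) (chiBracket ν star χ χ') g (vBracket Ex f) b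
      + (Fintype.card n : ℝ) / 2 * Real.log (2 * π) :=
  eq338_concrete hz (B14Eq333Proof.posDef_transpose_mul_mul hΔ hC) h0 hbond h330 h332 hχ hχt hEx hft

end Eq338

/-! ## §4  (3.42) for the concrete per-bond terms -/

section Eq342

variable {d : ℕ} {Z : Type*} [Fintype Z] {X : Type*} [Fintype X] [DecidableEq X]
  {Ω : Type*} [MeasurableSpace Ω]

/-- **(3.42) for the concrete (3.37)** (p. 275: *"The equality (3.38) implies [the logarithm on the right-hand side of
(3.28)] = Σ_{z∈Λ^{(k+1)}_{k+1}} 𝐄₀^{(k+1)}(Λ_{k+1}, z) + const"*) on the whole periodic lattice: fine bonds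
`β = X × Fin d` (`⟨x, x+e_μ⟩ ↔ (x, μ)`), coarse bonds `γ = Z × Fin d`, backward translations `back μ` bijective, tent
weights `Σ_z h_z(x) = 1` ((3.40)); the per-site terms are `B14.Eq338Localization.E0site` of the CONCRETE per-bond terms,
the constant is that of (3.33). [cite: Balaban1988Convergent, (3.42) p.275] -/
theorem eq342_concrete {L chiLog g : ℝ} {z : Z × Fin d → ℝ} (hz : ∀ c, 0 < z c) {T : Matrix n n ℝ} (hT : T.PosDef)
    {lam0 : ℝ} (h0 : 0 < lam0) {bond : n → X × Fin d} {star : Finset (X × Fin d)} (hbond : ∀ i, bond i ∈ star)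
    {ν : Measure Ω} {χ χ' : X × Fin d → ℝ → Ω → ℝ} {Ex : ℝ → (Ω → ℝ) → ℝ} {f : X × Fin d → ℝ → Ω → ℝ}
    (h330 : L = Real.log ((∏ c, z c) * ∫ A : n → ℝ, Real.exp (-(1/2 : ℝ) * (A ⬝ᵥ T *ᵥ A)))
      + chiLog + g * ∫ t in (0:ℝ)..1, Ex t (fun ω => ∑ b, f b t ω))
    (h332 : chiLog = ∫ t in (0:ℝ)..1, (∫ ω, dchiProd star χ χ' t ω ∂ν) * (∫ ω, chiProd star χ t ω ∂ν)⁻¹)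
    (hχ : ∀ t ∈ Icc (0:ℝ) 1, ∀ b ∈ star, Integrable (fun ω => (∏ b' ∈ star.erase b, χ b' t ω) * χ' b t ω) ν)
    (hχt : ∀ b ∈ star, IntervalIntegrable
      (fun t => (∫ ω, (∏ b' ∈ star.erase b, χ b' t ω) * χ' b t ω ∂ν) * (∫ ω, chiProd star χ t ω ∂ν)⁻¹) volume 0 1)
    (hEx : ∀ t ∈ Icc (0:ℝ) 1, Ex t (fun ω => ∑ b, f b t ω) = ∑ b, Ex t (f b t))
    (hft : ∀ b, IntervalIntegrable (fun t => Ex t (f b t)) volume 0 1)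
    (h : Z → X → ℝ) {back : Fin d → Z → Z} (hback : ∀ μ, Function.Bijective (back μ)) (hh : ∀ x, ∑ z', h z' x = 1) :
    L = ∑ z', E0site (fun c => Real.log (z c)) h
          (E0 star (gauss337 T lam0 bond) (chiBracket ν star χ χ') g (vBracket Ex f)) back z'
      + (Fintype.card n : ℝ) / 2 * Real.log (2 * π) :=
  eq342 (fun c => Real.log (z c)) h _ (eq338_concrete hz hT h0 hbond h330 h332 hχ hχt hEx hft) hback hh

end Eq342

end Literature.MathematicalPhysics.QuantumFieldTheory.Balaban1983to89.B14.Eq338Concrete
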